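import Summits.ValiantsHypothesis.ValiantsHypothesis.Theorems.BinomialElusivePeelingLemmaGadgetDefs

/-!
# Route `BinomialElusive`, crux `PeelingLemma` (stmt-ValiantsHypothesis-7391) — vocabulary of the negative
lane, part 4: the theta gadget with SYMMETRIC closing order (route-posited object; blueprint §3d TODO(3))

Same gadget as `BinomialElusivePeelingLemmaGadgetDefs.lean` except for the order in which the plus letters of
`b'` are born along the closing segment of arm `j`: the odd closing birth `2k+1` is `beta' (armAge q j (2k))`
(the SAME transposition of the ages `2q` and `evenAge q j` that arm `j` uses at `b`) instead of the shifted
enumeration `skipAge`.  With this choice the vicinity of `b'`, read backwards in time, has exactly the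
combinatorics of the vicinity of `b` (arm `j` drops its special letter first, then the common age order), so
one branch lemma serves both ends.  Nothing here asserts anything.
-/

-- `Summit.ValiantsHypothesis.ValiantsHypothesis.…` is the tree's mandated single-conjunct layout
-- (Sub = Summit), so the duplicated namespace component is intended.
set_option linter.dupNamespace false

namespace Summit.ValiantsHypothesis.ValiantsHypothesis.Theorems.PeelingLemmaGadget

/-- Symmetric closing births: number `i ∈ [1, 2q]` after `ex j`: even `i` ↦ the minus letter `beta' (i-1)`,
odd `i = 2k+1` ↦ the plus letter `beta' (armAge q j (2k))` (all plus letters except the kept one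
`beta' (evenAge q j)`, in age order with `2q` taking the place of `evenAge q j`). -/
def closing2 (q no : ℕ) (j : Fin 5) (i : ℕ) : GLetter q no :=
  if i % 2 = 0 then GLetter.beta' ⟨min (i - 1) (2 * q), by omega⟩
  else GLetter.beta' (armAge q j ⟨min (i - 1) (2 * q), by omega⟩)

/-- Birth sequence on natural positions with the symmetric closing order (otherwise as `birthNat`). -/
def birthNat2 (q no : ℕ) (j : Fin 5) (n : ℕ) : GLetter q no :=
  if h₁ : n ≤ 2 * q then GLetter.beta (armAge q j ⟨2 * q - n, by omega⟩)
  else if h₂ : n ≤ 2 * q + no then GLetter.ord j ⟨n - (2 * q + 1), by omega⟩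
  else if n = 2 * q + no + 1 then GLetter.ex j
  else if n ≤ 4 * q + no + 1 then closing2 q no j (n - (2 * q + no + 1))
  else if n = 4 * q + no + 2 then GLetter.beta' (evenAge q j)
  else GLetter.junk n

/-- The symmetric-closing birth sequence of arm `j` on `ℤ` (junk at negative positions). -/
def birth2 (q no : ℕ) (j : Fin 5) (t : ℤ) : GLetter q no :=
  if t < 0 then GLetter.junk t else birthNat2 q no j t.toNat

end Summit.ValiantsHypothesis.ValiantsHypothesis.Theorems.PeelingLemmaGadget
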